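import Literature.NumberTheory.Sieve.BombieriFriedlanderIwaniecTheorem5Weights
import HarnessLib

/-!
# A smooth cut-off with plateau `[a, b]` and transitions of length `Y`

Topic `Literature/NumberTheory/Sieve` (source-independent analytic tool). The smoothed weights of
analytic number theory — "let `g : ℝ → [0, 1]` be a smooth function that is supported on `[1, 2]`
and equals `1` on `[1 + δ, 2 − δ]` … the derivatives of `g` satisfy `g^{(j)}(x) ≪ δ^{−j}`"
(Matomäki–Merikoski, arXiv:2112.11412, §2), "`Ψ(x) = 0` for `x ≤ 1` and `Ψ(x) = 1` for `x ≥ 2`",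
"`h(x) = 1` for `x ∈ [1/20, 20]`, supported on `[1/40, 40]`" (ibid. §7), BFI's `α(m)` (Acta Math.
156, §12) — are all instances of one construction, which this file provides with quantitative
derivative bounds, generalising the tree's `BFI.bump M Y` (plateau `[M, 2M]`,
`BombieriFriedlanderIwaniecTheorem5Weights.lean`) to an arbitrary plateau:

* `plateauCutoff a b Y u = ψ((u − a + Y)/Y) + ψ((b + Y − u)/Y) − 1`, `ψ = Real.smoothTransition`
  (a DEFINITION); `BFI.bump M Y = plateauCutoff M (2M) Y` (`bump_eq_plateauCutoff`);
* for `Y > 0`, `a ≤ b`: `= 1` on `[a, b]` (`plateauCutoff_eq_one`), `= 0` on `u ≤ a − Y` and on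
  `b + Y ≤ u` (`…_eq_zero_of_le`, `…_eq_zero_of_ge`), values in `[0, 1]` (`…_mem_Icc`), smooth
  (`contDiff_plateauCutoff`), `tsupport ⊆ [a − Y, b + Y]`, compact support;
* `iteratedDeriv_plateauCutoff`, **`norm_iteratedDeriv_plateauCutoff_le`**:
  `|g⁽ⁿ⁾| ≤ 2 Kₙ Y⁻ⁿ` for `n ≥ 1` (`Kₙ = BFI.derivConst n`, a bound for `ψ⁽ⁱ⁾`, `i ≤ n`), and
  `iteratedDeriv_plateauCutoff_eq_zero` off the two transition intervals;
* `sub_le_integral_plateauCutoff`, `integral_plateauCutoff_le`: `b − a ≤ ∫ g ≤ b − a + 2Y`;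
* the complexification `plateauCutoffC` (`‖·‖ ≤ 1`, smooth, same support and derivative bounds),
  ready for Mathlib's Fourier transform / the tree's Poisson summation files.

## References

* K. Matomäki, J. Merikoski, IMRN 2023 (arXiv:2112.11412), §2 (the weight `g`), §7 (`Ψ`, `F`, `h`).
  [cite: MatomakiMerikoski2023, §2]
* E. Bombieri, J. B. Friedlander, H. Iwaniec, Acta Math. 156 (1986), §12 pp. 235–236 (the weight
  `α(m)`; tree: `BFI.bump`). [cite: BombieriFriedlanderIwaniecActa1986, §12]
-/

noncomputable section

open Real MeasureTheory Set
open scoped ContDiff Topology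

namespace Literature.NumberTheory.Sieve

open BFI (derivConst one_le_derivConst norm_iteratedDeriv_smoothTransition_le)
open FriedlanderIwaniecPrimes (iteratedDeriv_smoothTransition_eq_zero)

/-! ### Definition and values -/

/-- **The smooth plateau cut-off** `g(u) = ψ((u − a + Y)/Y) + ψ((b + Y − u)/Y) − 1`,
`ψ = Real.smoothTransition`: for `Y > 0` and `a ≤ b` it is smooth, takes values in `[0, 1]`,
equals `1` on `[a, b]` and `0` outside `(a − Y, b + Y)`, with `|g⁽ⁿ⁾| ≤ 2Kₙ Y⁻ⁿ` (the weight
"`g` supported on `[1, 2]`, equal to `1` on `[1 + δ, 2 − δ]`, `g^{(j)} ≪ δ^{−j}`" of the source is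
`plateauCutoff (1 + δ) (2 − δ) δ`). [cite: MatomakiMerikoski2023, §2] -/
def plateauCutoff (a b Y : ℝ) (u : ℝ) : ℝ :=
  Real.smoothTransition (Y⁻¹ * (u + (Y - a))) +
    Real.smoothTransition ((-Y⁻¹) * (u + -(b + Y))) - 1

/-- The tree's dyadic bump is the case `[a, b] = [M, 2M]`. [folklore] -/
theorem bump_eq_plateauCutoff (M Y : ℝ) : BFI.bump M Y = plateauCutoff M (2 * M) Y := rfl

variable {a b Y u : ℝ}

/-- `g = 1` on `[a, b]`. [folklore] -/
theorem plateauCutoff_eq_one (hY : 0 < Y) (h1 : a ≤ u) (h2 : u ≤ b) : plateauCutoff a b Y u = 1 := by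
  unfold plateauCutoff
  rw [Real.smoothTransition.one_of_one_le, Real.smoothTransition.one_of_one_le]
  · ring
  · rw [neg_mul, ← mul_neg, le_inv_mul_iff₀ hY]; linarith
  · rw [le_inv_mul_iff₀ hY]; linarith

/-- `g = 0` to the left of `a − Y` (`a ≤ b`). [folklore] -/
theorem plateauCutoff_eq_zero_of_le (hY : 0 < Y) (hab : a ≤ b) (h : u ≤ a - Y) :
    plateauCutoff a b Y u = 0 := by
  unfold plateauCutoff
  rw [Real.smoothTransition.zero_of_nonpos, Real.smoothTransition.one_of_one_le]
  · ring
  · rw [neg_mul, ← mul_neg, le_inv_mul_iff₀ hY]; linarith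
  · rw [inv_mul_le_iff₀ hY]; linarith

/-- `g = 0` to the right of `b + Y` (`a ≤ b`). [folklore] -/
theorem plateauCutoff_eq_zero_of_ge (hY : 0 < Y) (hab : a ≤ b) (h : b + Y ≤ u) :
    plateauCutoff a b Y u = 0 := by
  unfold plateauCutoff
  rw [Real.smoothTransition.one_of_one_le, Real.smoothTransition.zero_of_nonpos]
  · ring
  · rw [neg_mul, ← mul_neg, inv_mul_le_iff₀ hY]; linarith
  · rw [le_inv_mul_iff₀ hY]; linarith

/-- `0 ≤ g ≤ 1` (`a ≤ b`). [folklore] -/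
theorem plateauCutoff_mem_Icc (hY : 0 < Y) (hab : a ≤ b) (u : ℝ) :
    plateauCutoff a b Y u ∈ Icc (0 : ℝ) 1 := by
  unfold plateauCutoff
  have h1 := Real.smoothTransition.nonneg (Y⁻¹ * (u + (Y - a)))
  have h2 := Real.smoothTransition.le_one (Y⁻¹ * (u + (Y - a)))
  have h3 := Real.smoothTransition.nonneg ((-Y⁻¹) * (u + -(b + Y)))
  have h4 := Real.smoothTransition.le_one ((-Y⁻¹) * (u + -(b + Y)))
  refine ⟨?_, by linarith⟩
  rcases le_total u a with hu | hu
  · rw [Real.smoothTransition.one_of_one_le (x := (-Y⁻¹) * (u + -(b + Y)))]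
    · linarith
    · rw [neg_mul, ← mul_neg, le_inv_mul_iff₀ hY]; linarith
  · rw [Real.smoothTransition.one_of_one_le (x := Y⁻¹ * (u + (Y - a)))]
    · linarith
    · rw [le_inv_mul_iff₀ hY]; linarith

/-- `0 ≤ g`. [folklore] -/
theorem plateauCutoff_nonneg (hY : 0 < Y) (hab : a ≤ b) (u : ℝ) : 0 ≤ plateauCutoff a b Y u :=
  (plateauCutoff_mem_Icc hY hab u).1

/-- `g ≤ 1`. [folklore] -/
theorem plateauCutoff_le_one (hY : 0 < Y) (hab : a ≤ b) (u : ℝ) : plateauCutoff a b Y u ≤ 1 :=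
  (plateauCutoff_mem_Icc hY hab u).2

/-- `|g| ≤ 1`. [folklore] -/
theorem abs_plateauCutoff_le_one (hY : 0 < Y) (hab : a ≤ b) (u : ℝ) : |plateauCutoff a b Y u| ≤ 1 := by
  have h := plateauCutoff_mem_Icc hY hab u
  rw [abs_le]; constructor <;> linarith [h.1, h.2]

/-! ### Smoothness, support and derivatives -/

/-- `g` is smooth. [folklore] -/
theorem contDiff_plateauCutoff (a b Y : ℝ) : ContDiff ℝ ∞ (plateauCutoff a b Y) := by
  unfold plateauCutoff
  refine ContDiff.sub (ContDiff.add ?_ ?_) contDiff_const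
  · exact Real.smoothTransition.contDiff.comp
      (contDiff_const.mul (contDiff_id.add contDiff_const))
  · exact Real.smoothTransition.contDiff.comp
      (contDiff_const.mul (contDiff_id.add contDiff_const))

/-- `g` is continuous. [folklore] -/
theorem continuous_plateauCutoff (a b Y : ℝ) : Continuous (plateauCutoff a b Y) :=
  (contDiff_plateauCutoff a b Y).continuous

/-- The support of `g` lies in `(a − Y, b + Y)`. [folklore] -/
theorem support_plateauCutoff_subset (hY : 0 < Y) (hab : a ≤ b) :
    Function.support (plateauCutoff a b Y) ⊆ Ioo (a - Y) (b + Y) := by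
  intro u hu
  rw [Function.mem_support] at hu
  rw [mem_Ioo]
  constructor
  · by_contra h
    exact hu (plateauCutoff_eq_zero_of_le hY hab (not_lt.mp h))
  · by_contra h
    exact hu (plateauCutoff_eq_zero_of_ge hY hab (not_lt.mp h))

/-- The topological support of `g` lies in `[a − Y, b + Y]`. [folklore] -/
theorem tsupport_plateauCutoff_subset (hY : 0 < Y) (hab : a ≤ b) :
    tsupport (plateauCutoff a b Y) ⊆ Icc (a - Y) (b + Y) :=
  closure_minimal ((support_plateauCutoff_subset hY hab).trans Ioo_subset_Icc_self) isClosed_Icc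

/-- `g` has compact support. [folklore] -/
theorem hasCompactSupport_plateauCutoff (hY : 0 < Y) (hab : a ≤ b) :
    HasCompactSupport (plateauCutoff a b Y) :=
  HasCompactSupport.of_support_subset_isCompact isCompact_Icc
    ((support_plateauCutoff_subset hY hab).trans Ioo_subset_Icc_self)

/-- The derivatives of order `n ≥ 1` (chain rule for the two affine arguments):
`g⁽ⁿ⁾(u) = Y⁻ⁿ ψ⁽ⁿ⁾((u − a + Y)/Y) + (−Y⁻¹)ⁿ ψ⁽ⁿ⁾((b + Y − u)/Y)`. [folklore] -/
theorem iteratedDeriv_plateauCutoff {n : ℕ} (hn : 1 ≤ n) (a b Y u : ℝ) :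
    iteratedDeriv n (plateauCutoff a b Y) u =
      Y⁻¹ ^ n * iteratedDeriv n Real.smoothTransition (Y⁻¹ * (u + (Y - a))) +
        (-Y⁻¹) ^ n * iteratedDeriv n Real.smoothTransition ((-Y⁻¹) * (u + -(b + Y))) := by
  have hψ : ContDiff ℝ n Real.smoothTransition := Real.smoothTransition.contDiff
  set g₁ : ℝ → ℝ := fun u => Real.smoothTransition (Y⁻¹ * (u + (Y - a))) with hg₁
  set g₂ : ℝ → ℝ := fun u => Real.smoothTransition ((-Y⁻¹) * (u + -(b + Y))) with hg₂
  have hc₁ : ContDiff ℝ n g₁ := hψ.comp (contDiff_const.mul (contDiff_id.add contDiff_const))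
  have hc₂ : ContDiff ℝ n g₂ := hψ.comp (contDiff_const.mul (contDiff_id.add contDiff_const))
  have hfun : plateauCutoff a b Y = fun u => (g₁ u + g₂ u) - (fun _ : ℝ => (1 : ℝ)) u := by
    funext v; rfl
  rw [hfun, iteratedDeriv_fun_sub (hc₁.add hc₂).contDiffAt contDiff_const.contDiffAt,
    iteratedDeriv_fun_add hc₁.contDiffAt hc₂.contDiffAt, iteratedDeriv_const]
  rw [if_neg (by omega), sub_zero]
  have e₁ : iteratedDeriv n g₁ u =
      Y⁻¹ ^ n * iteratedDeriv n Real.smoothTransition (Y⁻¹ * (u + (Y - a))) := by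
    have h := congrFun (iteratedDeriv_comp_add_const n
      (fun w => Real.smoothTransition (Y⁻¹ * w)) (Y - a)) u
    rw [iteratedDeriv_comp_const_mul hψ] at h
    exact h
  have e₂ : iteratedDeriv n g₂ u =
      (-Y⁻¹) ^ n * iteratedDeriv n Real.smoothTransition ((-Y⁻¹) * (u + -(b + Y))) := by
    have h := congrFun (iteratedDeriv_comp_add_const n
      (fun w => Real.smoothTransition ((-Y⁻¹) * w)) (-(b + Y))) u
    rw [iteratedDeriv_comp_const_mul hψ] at h
    exact h
  rw [e₁, e₂]

/-- **`|g⁽ⁿ⁾| ≤ 2 Kₙ Y⁻ⁿ`** for `n ≥ 1` and `Y > 0` (`Kₙ = BFI.derivConst n ≥ 1` bounds `ψ⁽ⁱ⁾`,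
`i ≤ n`): the shape "`g^{(j)}(x) ≪ δ^{−j}`". [cite: MatomakiMerikoski2023, §2] -/
theorem norm_iteratedDeriv_plateauCutoff_le {n : ℕ} (hn : 1 ≤ n) (hY : 0 < Y) (a b u : ℝ) :
    ‖iteratedDeriv n (plateauCutoff a b Y) u‖ ≤ 2 * derivConst n * Y⁻¹ ^ n := by
  rw [iteratedDeriv_plateauCutoff hn]
  refine (norm_add_le _ _).trans ?_
  rw [norm_mul, norm_mul, norm_pow, norm_pow, norm_neg, norm_inv, Real.norm_of_nonneg hY.le]
  have h1 := norm_iteratedDeriv_smoothTransition_le (le_refl n) (Y⁻¹ * (u + (Y - a)))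
  have h2 := norm_iteratedDeriv_smoothTransition_le (le_refl n) ((-Y⁻¹) * (u + -(b + Y)))
  have hY' : 0 ≤ Y⁻¹ ^ n := by positivity
  nlinarith [mul_le_mul_of_nonneg_left h1 hY', mul_le_mul_of_nonneg_left h2 hY']

/-- The same bound for all orders `i ≤ n` with the single constant `Kₙ` (for `i = 0` it reads
`|g| ≤ 1 ≤ 2Kₙ`), convenient when finitely many derivatives are controlled at once. [folklore] -/
theorem norm_iteratedDeriv_plateauCutoff_le_of_le {i n : ℕ} (hi : i ≤ n) (hY : 0 < Y)
    (hab : a ≤ b) (u : ℝ) :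
    ‖iteratedDeriv i (plateauCutoff a b Y) u‖ ≤ 2 * derivConst n * Y⁻¹ ^ i := by
  have hK := one_le_derivConst n
  rcases Nat.eq_zero_or_pos i with rfl | hi0
  · rw [iteratedDeriv_zero, pow_zero, mul_one, Real.norm_eq_abs]
    linarith [abs_plateauCutoff_le_one hY hab u]
  · rw [iteratedDeriv_plateauCutoff hi0]
    refine (norm_add_le _ _).trans ?_
    rw [norm_mul, norm_mul, norm_pow, norm_pow, norm_neg, norm_inv, Real.norm_of_nonneg hY.le]
    have h1 := norm_iteratedDeriv_smoothTransition_le hi (Y⁻¹ * (u + (Y - a)))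
    have h2 := norm_iteratedDeriv_smoothTransition_le hi ((-Y⁻¹) * (u + -(b + Y)))
    have hY' : 0 ≤ Y⁻¹ ^ i := by positivity
    nlinarith [mul_le_mul_of_nonneg_left h1 hY', mul_le_mul_of_nonneg_left h2 hY']

/-- For `n ≥ 1`, `g⁽ⁿ⁾` vanishes off `[a − Y, a] ∪ [b, b + Y]` (there `g` is locally constant).
[folklore] -/
theorem iteratedDeriv_plateauCutoff_eq_zero {n : ℕ} (hn : 1 ≤ n) (hY : 0 < Y) (hab : a ≤ b)
    (hu : u < a - Y ∨ (a < u ∧ u < b) ∨ b + Y < u) :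
    iteratedDeriv n (plateauCutoff a b Y) u = 0 := by
  rw [iteratedDeriv_plateauCutoff hn, iteratedDeriv_smoothTransition_eq_zero hn,
    iteratedDeriv_smoothTransition_eq_zero hn]
  · ring
  · rw [neg_mul, ← mul_neg, neg_add, neg_neg]
    rcases hu with hu | hu | hu
    · right; rw [lt_inv_mul_iff₀ hY]; linarith
    · right; rw [lt_inv_mul_iff₀ hY]; linarith
    · left; rw [inv_mul_lt_iff₀ hY]; linarith
  · rcases hu with hu | hu | hu
    · left; rw [inv_mul_lt_iff₀ hY]; linarith
    · right; rw [lt_inv_mul_iff₀ hY]; linarith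
    · right; rw [lt_inv_mul_iff₀ hY]; linarith

/-! ### The integral: `b − a ≤ ∫ g ≤ b − a + 2Y` -/

/-- `g` is integrable. [folklore] -/
theorem integrable_plateauCutoff (hY : 0 < Y) (hab : a ≤ b) : Integrable (plateauCutoff a b Y) :=
  (continuous_plateauCutoff a b Y).integrable_of_hasCompactSupport
    (hasCompactSupport_plateauCutoff hY hab)

/-- `∫ g ≤ b − a + 2Y`: `0 ≤ g ≤ 1` and `g` vanishes off `[a − Y, b + Y]`. [folklore] -/
theorem integral_plateauCutoff_le (hY : 0 < Y) (hab : a ≤ b) :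
    ∫ u, plateauCutoff a b Y u ≤ b - a + 2 * Y := by
  have hzero : ∀ u, u ∉ Icc (a - Y) (b + Y) → plateauCutoff a b Y u = 0 := by
    intro u hu
    by_contra h
    exact hu (Ioo_subset_Icc_self (support_plateauCutoff_subset hY hab (Function.mem_support.mpr h)))
  rw [← setIntegral_eq_integral_of_forall_compl_eq_zero hzero]
  calc ∫ u in Icc (a - Y) (b + Y), plateauCutoff a b Y u ≤ ∫ u in Icc (a - Y) (b + Y), (1 : ℝ) :=
        setIntegral_mono_on (integrable_plateauCutoff hY hab).integrableOn
          (continuous_const : Continuous fun _ : ℝ => (1 : ℝ)).integrableOn_Icc measurableSet_Icc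
          fun u _ => plateauCutoff_le_one hY hab u
    _ = b - a + 2 * Y := by
        rw [setIntegral_const, Real.volume_real_Icc_of_le (by linarith), smul_eq_mul]
        ring

/-- `b − a ≤ ∫ g`: `g ≥ 0` everywhere and `g = 1` on `[a, b]`. [folklore] -/
theorem sub_le_integral_plateauCutoff (hY : 0 < Y) (hab : a ≤ b) :
    b - a ≤ ∫ u, plateauCutoff a b Y u := by
  calc b - a = ∫ u in Icc a b, (1 : ℝ) := by
        rw [setIntegral_const, Real.volume_real_Icc_of_le hab, smul_eq_mul, mul_one]
    _ = ∫ u in Icc a b, plateauCutoff a b Y u :=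
        setIntegral_congr_fun measurableSet_Icc fun u hu =>
          (plateauCutoff_eq_one hY hu.1 hu.2).symm
    _ ≤ ∫ u, plateauCutoff a b Y u :=
        setIntegral_le_integral (integrable_plateauCutoff hY hab)
          (Filter.Eventually.of_forall fun u => plateauCutoff_nonneg hY hab u)

/-! ### The complexified cut-off -/

/-- `g` as a complex-valued function (for Mathlib's Fourier transform and the tree's Poisson
summation files). [folklore] -/
def plateauCutoffC (a b Y : ℝ) (t : ℝ) : ℂ := (plateauCutoff a b Y t : ℂ)

/-- Unfolding. [folklore] -/
theorem plateauCutoffC_apply (a b Y t : ℝ) : plateauCutoffC a b Y t = (plateauCutoff a b Y t : ℂ) := rfl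

/-- Smoothness. [folklore] -/
theorem contDiff_plateauCutoffC (a b Y : ℝ) : ContDiff ℝ ∞ (plateauCutoffC a b Y) :=
  Complex.ofRealCLM.contDiff.comp (contDiff_plateauCutoff a b Y)

/-- `‖gℂ‖ ≤ 1`. [folklore] -/
theorem norm_plateauCutoffC_le_one (hY : 0 < Y) (hab : a ≤ b) (t : ℝ) : ‖plateauCutoffC a b Y t‖ ≤ 1 := by
  rw [plateauCutoffC_apply, Complex.norm_real, Real.norm_eq_abs]
  exact abs_plateauCutoff_le_one hY hab t

/-- `tsupport gℂ ⊆ [a − Y, b + Y]`. [folklore] -/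
theorem tsupport_plateauCutoffC_subset (hY : 0 < Y) (hab : a ≤ b) :
    tsupport (plateauCutoffC a b Y) ⊆ Icc (a - Y) (b + Y) := by
  refine closure_minimal (fun t ht => ?_) isClosed_Icc
  rw [Function.mem_support, plateauCutoffC_apply, Ne, Complex.ofReal_eq_zero] at ht
  exact Ioo_subset_Icc_self (support_plateauCutoff_subset hY hab (Function.mem_support.mpr ht))

/-- Compact support. [folklore] -/
theorem hasCompactSupport_plateauCutoffC (hY : 0 < Y) (hab : a ≤ b) :
    HasCompactSupport (plateauCutoffC a b Y) :=
  HasCompactSupport.of_support_subset_isCompact isCompact_Icc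
    ((subset_tsupport _).trans (tsupport_plateauCutoffC_subset hY hab))

/-- The derivatives of the complexification are those of `g`: `‖gℂ⁽ⁿ⁾(t)‖ ≤ ‖g⁽ⁿ⁾(t)‖`.
[folklore] -/
theorem norm_iteratedDeriv_plateauCutoffC_le_real (n : ℕ) (a b Y t : ℝ) :
    ‖iteratedDeriv n (plateauCutoffC a b Y) t‖ ≤ ‖iteratedDeriv n (plateauCutoff a b Y) t‖ := by
  rw [← norm_iteratedFDeriv_eq_norm_iteratedDeriv, ← norm_iteratedFDeriv_eq_norm_iteratedDeriv]
  have h := ContinuousLinearMap.iteratedFDeriv_comp_left (x := t) (i := n) Complex.ofRealCLM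
    ((contDiff_plateauCutoff a b Y).contDiffAt) (by exact_mod_cast le_top)
  have hfun : plateauCutoffC a b Y = ⇑Complex.ofRealCLM ∘ plateauCutoff a b Y := rfl
  rw [hfun, h]
  refine (ContinuousLinearMap.norm_compContinuousMultilinearMap_le _ _).trans ?_
  rw [Complex.ofRealCLM_norm, one_mul]

/-- **`‖gℂ⁽ⁿ⁾‖ ≤ 2Kₙ Y⁻ⁿ`** for `n ≥ 1`. [folklore] -/
theorem norm_iteratedDeriv_plateauCutoffC_le {n : ℕ} (hn : 1 ≤ n) (hY : 0 < Y) (a b t : ℝ) :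
    ‖iteratedDeriv n (plateauCutoffC a b Y) t‖ ≤ 2 * derivConst n * Y⁻¹ ^ n :=
  (norm_iteratedDeriv_plateauCutoffC_le_real n a b Y t).trans
    (norm_iteratedDeriv_plateauCutoff_le hn hY a b t)

end Literature.NumberTheory.Sieve
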